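import Summits.Parity.GeneralizedHardyLittlewood.Theses.LiouvilleShiftedTables
import Summits.Parity.GeneralizedHardyLittlewood.Theorems.TableChowla.Negative.TableChowlaEquivalentForms

/-!
# `TableChowla` (stmt-Parity-14270): the exceptional-set form and the implied fixed-residue
# level-of-distribution face

Support lemmas for the crux `LiouvilleShiftedTables.TableChowla` (cdisprove seat):
* `tableChowla_iff_fewBadPairs` — the crux is EXACTLY the smallness, `≤ x²/(B²(log x)^{C'})`
  for every `C'`, of the set of row pairs with `|S(a,a')| ≥ B/(log x)^C`, for every `C`
  (provers may count biased pairs, large-values style; refuters must produce `≫ A²/(log x)^{C'}`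
  of them);
* HARDNESS CALIBRATION — `fixedResidueFace_of_tableChowla`: the crux implies
  `Σ_{b ≤ x/A} |Σ_{a ∈ (A,2A]} λ(ab+c)| ≤ x/(log x)^C` for every `C` (two Cauchy–Schwarz steps,
  `sq_sum_abs_colSum_le`; the Linnik identity `sum_colSum_sq`), a fixed-residue, absolute-value
  level of distribution `1 − δ` for `λ` (unconditionally known at level `1/2` only): depth, not
  falsity.
[folklore]
-/

namespace Summit.Parity.GeneralizedHardyLittlewood.Theorems.TableChowla.Negative

open Finset Real ArithmeticFunction
open Summit.Parity.GeneralizedHardyLittlewood.Theses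

noncomputable section

/-- Number of `η`-biased row pairs of the table at `(x, A, c)`: `|S(a,a')| ≥ η·B`, `B = ⌊x/A⌋`
(diagonal pairs included — there are only `rows ≍ A` of them). -/
def badPairs (c : ℤ) (x A η : ℝ) : ℕ :=
  (((Ioc ⌊A⌋₊ ⌊2 * A⌋₊) ×ˢ (Ioc ⌊A⌋₊ ⌊2 * A⌋₊)).filter (fun p : ℕ × ℕ =>
      η * ⌊x / A⌋₊ ≤ |rowCorr lam c ⌊x / A⌋₊ p.1 p.2|)).card

/-- FEW BAD PAIRS at every pair of log-power scales. -/
def FewBadPairs : Prop :=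
  ∀ c : ℤ, c ≠ 0 → ∀ δ : ℝ, 0 < δ → δ ≤ 1 / 12 → ∀ C : ℝ, 0 < C → ∀ C' : ℝ, 0 < C' →
    ∃ x₀ : ℝ, ∀ x : ℝ, x₀ ≤ x → ∀ A : ℝ, x ^ δ ≤ A → A ≤ x ^ (1 / 3 + δ) →
      (badPairs c x A (Real.log x ^ C)⁻¹ : ℝ) ≤ x ^ 2 / ((⌊x / A⌋₊ : ℝ) ^ 2 * Real.log x ^ C')

/-- Window bookkeeping: `rows · B ≤ 2x` and `1 ≤ B` for `x ≥ 1`, `A` in the window. -/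
theorem rows_mul_cols_le_window {x A δ : ℝ} (hx1 : 1 ≤ x) (hδ : 0 ≤ δ) (hδ' : δ ≤ 2 / 3)
    (hA : x ^ δ ≤ A) (hA' : A ≤ x ^ (1 / 3 + δ)) :
    ((⌊2 * A⌋₊ - ⌊A⌋₊ : ℕ) : ℝ) * (⌊x / A⌋₊ : ℝ) ≤ 2 * x ∧ 1 ≤ ⌊x / A⌋₊ := by
  have hAone : 1 ≤ A := le_trans (Real.one_le_rpow hx1 hδ) hA
  have hApos : 0 < A := by linarith
  have hxpos : 0 < x := by linarith
  have hcardR : ((⌊2 * A⌋₊ - ⌊A⌋₊ : ℕ) : ℝ) ≤ 2 * A := by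
    rw [Nat.cast_sub (Nat.floor_le_floor (by linarith : A ≤ 2 * A))]
    have h1 : (⌊2 * A⌋₊ : ℝ) ≤ 2 * A := Nat.floor_le (by linarith)
    have h2 : A - 1 < (⌊A⌋₊ : ℝ) := by have := Nat.lt_floor_add_one A; linarith
    linarith
  have hBle : (⌊x / A⌋₊ : ℝ) ≤ x / A := Nat.floor_le (by positivity)
  refine ⟨?_, ?_⟩
  · calc ((⌊2 * A⌋₊ - ⌊A⌋₊ : ℕ) : ℝ) * (⌊x / A⌋₊ : ℝ) ≤ (2 * A) * (x / A) :=
          mul_le_mul hcardR hBle (by positivity) (by positivity)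
      _ = 2 * x := by field_simp
  · rw [Nat.one_le_floor_iff, le_div_iff₀ hApos, one_mul]
    calc A ≤ x ^ (1 / 3 + δ) := hA'
      _ ≤ x ^ (1 : ℝ) := Real.rpow_le_rpow_of_exponent_le hx1 (by linarith)
      _ = x := Real.rpow_one x

/-- EVENTUALITY: beyond some `X(C, M)`, `M ≤ (log x)^C` and `2 ≤ log x`. -/
theorem eventually_rpow_log_ge {C : ℝ} (hC : 0 < C) (M : ℝ) :
    ∃ X : ℝ, ∀ x : ℝ, X ≤ x → M ≤ Real.log x ^ C ∧ 2 ≤ Real.log x := by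
  set M₁ : ℝ := (max M 1) ^ (1 / C) with hM₁
  refine ⟨Real.exp (max M₁ 2), fun x hx => ?_⟩
  have hxpos : 0 < x := (Real.exp_pos _).trans_le hx
  have hlog : max M₁ 2 ≤ Real.log x := (Real.le_log_iff_exp_le hxpos).mpr hx
  have h2 : 2 ≤ Real.log x := le_trans (le_max_right _ _) hlog
  have hM₁le : M₁ ≤ Real.log x := le_trans (le_max_left _ _) hlog
  have hM₁nn : 0 ≤ M₁ := by rw [hM₁]; positivity
  refine ⟨?_, h2⟩
  calc M ≤ max M 1 := le_max_left _ _
    _ = M₁ ^ C := by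
        rw [hM₁, ← Real.rpow_mul (by positivity), one_div_mul_cancel hC.ne', Real.rpow_one]
    _ ≤ Real.log x ^ C := Real.rpow_le_rpow hM₁nn hM₁le hC.le

/-- `TableChowla → FewBadPairs` (Chebyshev at level `C' + 2C`). -/
theorem fewBadPairs_of_tableChowla (h : LiouvilleShiftedTables.TableChowla) : FewBadPairs := by
  intro c hc δ hδ hδ' C hC C' hC'
  obtain ⟨x₀, hx₀⟩ := badPairs_card_le h hc hδ hδ' (C := C' + 2 * C) (by positivity)
  refine ⟨max x₀ 2, fun x hx A hA hA' => ?_⟩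
  have hx₀x : x₀ ≤ x := le_trans (le_max_left _ _) hx
  have hx2 : (2 : ℝ) ≤ x := le_trans (le_max_right _ _) hx
  have hx1 : (1 : ℝ) ≤ x := by linarith
  have hlogpos : 0 < Real.log x := Real.log_pos (by linarith)
  set L : ℝ := Real.log x ^ C with hL
  set L' : ℝ := Real.log x ^ C' with hL'
  have hLpos : 0 < L := Real.rpow_pos_of_pos hlogpos C
  have hL'pos : 0 < L' := Real.rpow_pos_of_pos hlogpos C'
  obtain ⟨_, hB1⟩ := rows_mul_cols_le_window hx1 hδ.le (by linarith) hA hA'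
  set Bn : ℕ := ⌊x / A⌋₊ with hBn
  have hBpos : (0 : ℝ) < Bn := by exact_mod_cast hB1
  have key := hx₀ x hx₀x A hA hA' L⁻¹ (by positivity)
  have hsplit : Real.log x ^ (C' + 2 * C) = L' * L ^ 2 := by
    rw [Real.rpow_add hlogpos, hL, hL', show (2 : ℝ) * C = C + C by ring, Real.rpow_add hlogpos, sq]
  rw [hsplit, ← hBn] at key
  -- key : #bad * (L⁻¹ * Bn)² ≤ x² / (L' * L²) ; goal : #bad ≤ x² / (Bn² * L')
  show (badPairs c x A L⁻¹ : ℝ) ≤ x ^ 2 / ((Bn : ℝ) ^ 2 * L')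
  have e1 : (badPairs c x A L⁻¹ : ℝ) =
      (badPairs c x A L⁻¹ : ℝ) * (L⁻¹ * Bn) ^ 2 * (L ^ 2 / (Bn : ℝ) ^ 2) := by
    field_simp
  rw [e1]
  calc (badPairs c x A L⁻¹ : ℝ) * (L⁻¹ * Bn) ^ 2 * (L ^ 2 / (Bn : ℝ) ^ 2)
      ≤ x ^ 2 / (L' * L ^ 2) * (L ^ 2 / (Bn : ℝ) ^ 2) :=
        mul_le_mul_of_nonneg_right key (by positivity)
    _ = x ^ 2 / ((Bn : ℝ) ^ 2 * L') := by field_simp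

/-- `FewBadPairs → TableChowla` (biased pairs cost `B²` each, unbiased ones `(ηB)²` each). -/
theorem tableChowla_of_fewBadPairs (h : FewBadPairs) : LiouvilleShiftedTables.TableChowla := by
  rw [tableChowla_iff]
  intro c hc δ hδ hδ' C hC
  obtain ⟨x₀, hx₀⟩ := h c hc δ hδ hδ' C hC (C + 1) (by linarith)
  obtain ⟨X, hX⟩ := eventually_rpow_log_ge hC 8
  refine ⟨max x₀ (max X 1), fun x hx A hA hA' => ?_⟩
  have hx₀x : x₀ ≤ x := le_trans (le_max_left _ _) hx
  have hxX : X ≤ x := le_trans (le_trans (le_max_left _ _) (le_max_right _ _)) hx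
  have hx1 : 1 ≤ x := le_trans (le_trans (le_max_right _ _) (le_max_right _ _)) hx
  have hxpos : 0 < x := by linarith
  obtain ⟨hL8, hlog2⟩ := hX x hxX
  have hlogpos : 0 < Real.log x := by linarith
  set L : ℝ := Real.log x ^ C with hL
  have hLpos : 0 < L := Real.rpow_pos_of_pos hlogpos C
  obtain ⟨hRB, hB1⟩ := rows_mul_cols_le_window hx1 hδ.le (by linarith) hA hA'
  set S : Finset ℕ := Ioc ⌊A⌋₊ ⌊2 * A⌋₊ with hS
  set Bn : ℕ := ⌊x / A⌋₊ with hBn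
  have hBpos : (0 : ℝ) < Bn := by exact_mod_cast hB1
  have hbad := hx₀ x hx₀x A hA hA'
  rw [Real.rpow_add hlogpos, Real.rpow_one, ← hL, ← hBn] at hbad
  -- hbad : #bad ≤ x² / (Bn² * (L * log x))
  -- split T over bad / good pairs
  set P : ℕ × ℕ → Prop := fun p => L⁻¹ * Bn ≤ |rowCorr lam c Bn p.1 p.2| with hP
  have hT : momentN lam c ⌊A⌋₊ ⌊2 * A⌋₊ Bn = ∑ p ∈ S ×ˢ S, rowCorr lam c Bn p.1 p.2 ^ 2 := by
    unfold momentN; rw [sum_product]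
  have hsplitsum := (Finset.sum_filter_add_sum_filter_not (S ×ˢ S) P
    (fun p => rowCorr lam c Bn p.1 p.2 ^ 2)).symm
  -- bad part
  have hbadcard : (((S ×ˢ S).filter P).card : ℝ) = (badPairs c x A L⁻¹ : ℝ) := by
    simp only [badPairs, hS, hBn, hP]
  have hbadsum : ∑ p ∈ (S ×ˢ S).filter P, rowCorr lam c Bn p.1 p.2 ^ 2 ≤ x ^ 2 / (L * Real.log x) := by
    calc ∑ p ∈ (S ×ˢ S).filter P, rowCorr lam c Bn p.1 p.2 ^ 2
        ≤ ∑ _p ∈ (S ×ˢ S).filter P, (Bn : ℝ) ^ 2 := by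
          refine sum_le_sum fun p _ => ?_
          have hb := abs_rowCorr_le (c := c) (B := Bn) abs_lam_le_one p.1 p.2
          exact sq_le_sq' (by linarith [(abs_le.mp hb).1]) (abs_le.mp hb).2
      _ = (badPairs c x A L⁻¹ : ℝ) * (Bn : ℝ) ^ 2 := by rw [sum_const, nsmul_eq_mul, hbadcard]
      _ ≤ x ^ 2 / ((Bn : ℝ) ^ 2 * (L * Real.log x)) * (Bn : ℝ) ^ 2 :=
          mul_le_mul_of_nonneg_right hbad (by positivity)
      _ = x ^ 2 / (L * Real.log x) := by field_simp
  -- good part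
  have hgoodsum : ∑ p ∈ (S ×ˢ S).filter (fun p => ¬ P p), rowCorr lam c Bn p.1 p.2 ^ 2 ≤
      (2 * x) ^ 2 * L⁻¹ ^ 2 := by
    calc ∑ p ∈ (S ×ˢ S).filter (fun p => ¬ P p), rowCorr lam c Bn p.1 p.2 ^ 2
        ≤ ∑ _p ∈ (S ×ˢ S).filter (fun p => ¬ P p), (L⁻¹ * Bn) ^ 2 := by
          refine sum_le_sum fun p hp => ?_
          have hnp : ¬ P p := (mem_filter.mp hp).2
          have hlt : |rowCorr lam c Bn p.1 p.2| < L⁻¹ * Bn := lt_of_not_ge hnp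
          have hnn : 0 ≤ L⁻¹ * (Bn : ℝ) := by positivity
          exact sq_le_sq' (by linarith [(abs_lt.mp hlt).1]) (abs_lt.mp hlt).2.le
      _ ≤ ∑ _p ∈ S ×ˢ S, (L⁻¹ * Bn) ^ 2 :=
          sum_le_sum_of_subset_of_nonneg (filter_subset _ _) fun _ _ _ => sq_nonneg _
      _ = ((S.card : ℝ) * Bn) ^ 2 * L⁻¹ ^ 2 := by
          rw [sum_const, nsmul_eq_mul, card_product]; push_cast; ring
      _ ≤ (2 * x) ^ 2 * L⁻¹ ^ 2 := by
          apply mul_le_mul_of_nonneg_right _ (sq_nonneg _)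
          have hRB' : (S.card : ℝ) * Bn ≤ 2 * x := by rw [hS, Nat.card_Ioc]; exact hRB
          exact pow_le_pow_left₀ (by positivity) hRB' 2
  -- assemble
  have t1 : x ^ 2 / (L * Real.log x) ≤ x ^ 2 / (2 * L) := by
    apply div_le_div_of_nonneg_left (by positivity) (by positivity); nlinarith
  have t2 : (2 * x) ^ 2 * L⁻¹ ^ 2 ≤ x ^ 2 / (2 * L) := by
    rw [inv_pow, ← div_eq_mul_inv, div_le_div_iff₀ (by positivity) (by positivity)]
    nlinarith [mul_nonneg (sq_nonneg x) hLpos.le]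
  have t5 : x ^ 2 / (2 * L) + x ^ 2 / (2 * L) = x ^ 2 / L := by field_simp; ring
  show momentN lam c ⌊A⌋₊ ⌊2 * A⌋₊ ⌊x / A⌋₊ ≤ x ^ 2 / L
  rw [← hBn, hT, hsplitsum]
  linarith

/-- EQUIVALENT FORM 5: the crux is exactly the smallness of the exceptional set of biased row
pairs at every pair of log-power scales. -/
theorem tableChowla_iff_fewBadPairs : LiouvilleShiftedTables.TableChowla ↔ FewBadPairs :=
  ⟨fewBadPairs_of_tableChowla, tableChowla_of_fewBadPairs⟩

/-- Column sums `G(b) = Σ_{a ∈ (A₁,A₂]} f(ab+c)`: `f` along `x^δ` consecutive terms of the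
progression `c (mod b)`. -/
def colSum (f : ℕ → ℝ) (c : ℤ) (A₁ A₂ b : ℕ) : ℝ :=
  ∑ a ∈ Ioc A₁ A₂, f (Int.toNat ((a : ℤ) * b + c))

variable {f : ℕ → ℝ} {c : ℤ} {A₁ A₂ B : ℕ}

/-- Linnik/dispersion identity: `Σ_b G(b)² = Σ_{a,a'} S(a,a')`. -/
theorem sum_colSum_sq : ∑ b ∈ Icc 1 B, colSum f c A₁ A₂ b ^ 2 =
    ∑ a ∈ Ioc A₁ A₂, ∑ a' ∈ Ioc A₁ A₂, rowCorr f c B a a' := by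
  unfold colSum rowCorr
  simp_rw [sq, sum_mul_sum]
  simp_rw [sum_comm (s := Ioc A₁ A₂) (t := Icc 1 B)]

/-- Two Cauchy–Schwarz steps (ideator 3's abstract heart, re-proved): `(Σ_b |G(b)|)² ≤ B·rows·√T`. -/
theorem sq_sum_abs_colSum_le :
    (∑ b ∈ Icc 1 B, |colSum f c A₁ A₂ b|) ^ 2 ≤
      (B : ℝ) * (Ioc A₁ A₂).card * Real.sqrt (momentN f c A₁ A₂ B) := by
  -- step 1: CS over b
  have h1 : (∑ b ∈ Icc 1 B, |colSum f c A₁ A₂ b|) ^ 2 ≤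
      (B : ℝ) * ∑ b ∈ Icc 1 B, colSum f c A₁ A₂ b ^ 2 := by
    have := sum_mul_sq_le_sq_mul_sq (Icc 1 B) (fun _ => (1 : ℝ)) (fun b => |colSum f c A₁ A₂ b|)
    simpa [sq_abs] using this
  -- step 2: CS over pairs: Σ_{a,a'} S ≤ rows √T
  have hT0 : 0 ≤ momentN f c A₁ A₂ B := momentN_nonneg
  have h3 : (∑ a ∈ Ioc A₁ A₂, ∑ a' ∈ Ioc A₁ A₂, rowCorr f c B a a') ^ 2 ≤
      ((Ioc A₁ A₂).card : ℝ) ^ 2 * momentN f c A₁ A₂ B := by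
    have hcs := sum_mul_sq_le_sq_mul_sq (Ioc A₁ A₂ ×ˢ Ioc A₁ A₂) (fun _ => (1 : ℝ))
      (fun p => rowCorr f c B p.1 p.2)
    have e1 : ∑ p ∈ Ioc A₁ A₂ ×ˢ Ioc A₁ A₂, (1 : ℝ) * rowCorr f c B p.1 p.2 =
        ∑ a ∈ Ioc A₁ A₂, ∑ a' ∈ Ioc A₁ A₂, rowCorr f c B a a' := by
      rw [sum_product]; simp
    have e2 : ∑ p ∈ Ioc A₁ A₂ ×ˢ Ioc A₁ A₂, rowCorr f c B p.1 p.2 ^ 2 = momentN f c A₁ A₂ B := by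
      unfold momentN; rw [sum_product]
    have e3 : ∑ _p ∈ Ioc A₁ A₂ ×ˢ Ioc A₁ A₂, (1 : ℝ) ^ 2 = ((Ioc A₁ A₂).card : ℝ) ^ 2 := by
      simp [card_product, sq]
    rw [e1, e2, e3] at hcs
    exact hcs
  have h4 : ∑ a ∈ Ioc A₁ A₂, ∑ a' ∈ Ioc A₁ A₂, rowCorr f c B a a' ≤
      ((Ioc A₁ A₂).card : ℝ) * Real.sqrt (momentN f c A₁ A₂ B) := by
    have hsq : (∑ a ∈ Ioc A₁ A₂, ∑ a' ∈ Ioc A₁ A₂, rowCorr f c B a a') ^ 2 ≤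
        (((Ioc A₁ A₂).card : ℝ) * Real.sqrt (momentN f c A₁ A₂ B)) ^ 2 := by
      rw [mul_pow, Real.sq_sqrt hT0]; exact h3
    exact (abs_le_of_sq_le_sq' hsq (by positivity)).2
  calc (∑ b ∈ Icc 1 B, |colSum f c A₁ A₂ b|) ^ 2
      ≤ (B : ℝ) * ∑ b ∈ Icc 1 B, colSum f c A₁ A₂ b ^ 2 := h1
    _ = (B : ℝ) * ∑ a ∈ Ioc A₁ A₂, ∑ a' ∈ Ioc A₁ A₂, rowCorr f c B a a' := by rw [sum_colSum_sq]
    _ ≤ (B : ℝ) * (((Ioc A₁ A₂).card : ℝ) * Real.sqrt (momentN f c A₁ A₂ B)) :=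
        mul_le_mul_of_nonneg_left h4 (Nat.cast_nonneg _)
    _ = _ := by ring

/-- The fixed-residue ℓ¹ level-of-distribution face for `λ` at level `1 − δ`. -/
def FixedResidueFace : Prop :=
  ∀ c : ℤ, c ≠ 0 → ∀ δ : ℝ, 0 < δ → δ ≤ 1 / 12 → ∀ C : ℝ, 0 < C → ∃ x₀ : ℝ, ∀ x : ℝ, x₀ ≤ x →
    ∀ A : ℝ, x ^ δ ≤ A → A ≤ x ^ (1 / 3 + δ) →
      (∑ b ∈ Icc 1 ⌊x / A⌋₊, |colSum lam c ⌊A⌋₊ ⌊2 * A⌋₊ b|) ≤ x / Real.log x ^ C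

/-- **`TableChowla → FixedResidueFace`** (crux at level `4C + 4`, then `(Σ|G|)² ≤ 2x²/(log x)^{2C+2}
≤ (x/(log x)^C)²` once `(log x)² ≥ 2`). -/
theorem fixedResidueFace_of_tableChowla (h : LiouvilleShiftedTables.TableChowla) :
    FixedResidueFace := by
  intro c hc δ hδ hδ' C hC
  obtain ⟨x₀, hx₀⟩ := (tableChowla_iff.mp h) c hc δ hδ hδ' (4 * C + 4) (by positivity)
  obtain ⟨X, hX⟩ := eventually_rpow_log_ge hC 0
  refine ⟨max x₀ (max X 1), fun x hx A hA hA' => ?_⟩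
  have hx₀x : x₀ ≤ x := le_trans (le_max_left _ _) hx
  have hxX : X ≤ x := le_trans (le_trans (le_max_left _ _) (le_max_right _ _)) hx
  have hx1 : 1 ≤ x := le_trans (le_trans (le_max_right _ _) (le_max_right _ _)) hx
  have hxpos : 0 < x := by linarith
  obtain ⟨_, hlog2⟩ := hX x hxX
  have hlogpos : 0 < Real.log x := by linarith
  set L : ℝ := Real.log x ^ C with hL
  have hLpos : 0 < L := Real.rpow_pos_of_pos hlogpos C
  obtain ⟨hRB, _⟩ := rows_mul_cols_le_window hx1 hδ.le (by linarith) hA hA'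
  have key := hx₀ x hx₀x A hA hA'
  -- √T ≤ x / (L² (log x)²)
  have hpow : Real.log x ^ (4 * C + 4) = (L ^ 2 * Real.log x ^ 2) ^ 2 := by
    rw [hL, show (4 : ℝ) * C + 4 = (C + C + 1 + 1) + (C + C + 1 + 1) by ring,
      Real.rpow_add hlogpos, Real.rpow_add hlogpos, Real.rpow_add hlogpos, Real.rpow_add hlogpos,
      Real.rpow_one]
    ring
  have hsqrtT : Real.sqrt (moment lam c x A) ≤ x / (L ^ 2 * Real.log x ^ 2) := by
    rw [hpow] at key
    calc Real.sqrt (moment lam c x A) ≤ Real.sqrt (x ^ 2 / (L ^ 2 * Real.log x ^ 2) ^ 2) :=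
          Real.sqrt_le_sqrt key
      _ = x / (L ^ 2 * Real.log x ^ 2) := by
          rw [← div_pow, Real.sqrt_sq (by positivity)]
  have hcs := sq_sum_abs_colSum_le (f := lam) (c := c) (A₁ := ⌊A⌋₊) (A₂ := ⌊2 * A⌋₊) (B := ⌊x / A⌋₊)
  rw [Nat.card_Ioc] at hcs
  have hmom : momentN lam c ⌊A⌋₊ ⌊2 * A⌋₊ ⌊x / A⌋₊ = moment lam c x A := rfl
  rw [hmom] at hcs
  -- (Σ|G|)² ≤ B rows √T ≤ 2x · x/(L² log²) ≤ (x/L)²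
  have hbound : (∑ b ∈ Icc 1 ⌊x / A⌋₊, |colSum lam c ⌊A⌋₊ ⌊2 * A⌋₊ b|) ^ 2 ≤ (x / L) ^ 2 := by
    calc (∑ b ∈ Icc 1 ⌊x / A⌋₊, |colSum lam c ⌊A⌋₊ ⌊2 * A⌋₊ b|) ^ 2
        ≤ (⌊x / A⌋₊ : ℝ) * ((⌊2 * A⌋₊ - ⌊A⌋₊ : ℕ) : ℝ) * Real.sqrt (moment lam c x A) := hcs
      _ ≤ (2 * x) * (x / (L ^ 2 * Real.log x ^ 2)) := by
          apply mul_le_mul _ hsqrtT (Real.sqrt_nonneg _) (by positivity)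
          rw [mul_comm]; exact hRB
      _ ≤ (x / L) ^ 2 := by
          rw [div_pow, show (2 * x) * (x / (L ^ 2 * Real.log x ^ 2)) = x ^ 2 / L ^ 2 * (2 / Real.log x ^ 2) by
            field_simp]
          apply mul_le_of_le_one_right (by positivity)
          rw [div_le_one (by positivity)]
          nlinarith
  have hnn : 0 ≤ ∑ b ∈ Icc 1 ⌊x / A⌋₊, |colSum lam c ⌊A⌋₊ ⌊2 * A⌋₊ b| :=
    sum_nonneg fun _ _ => abs_nonneg _
  exact (pow_le_pow_iff_left₀ hnn (by positivity) two_ne_zero).mp hbound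

end

end Summit.Parity.GeneralizedHardyLittlewood.Theorems.TableChowla.Negative
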